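import Summits.Schanuel.Schanuel.Theorems.RootDecomp1HSpineHeight

/-!
# RootDecomp1HSpine — continuation (RootDecomp1HSpine): §7 the node (live deciding theorem CALLED; cell (n,1) placed under the route binders: node_closes, *_apply_cell, cell_nodeN) + §8 every cell (n,1) is inhabited (IVT: iter … cell_inhabitedN)

Part of the six-file split (400-line rule) of lens 5's gen-11 node «CyclicSpine» = HOME/decomp-schanuel-lens-5/g11/Spine.lean
(sha256 ea4c5941…; ROUND 11 of route-Schanuel-RootDecomp1H, a THEOREM ROUND; `--supports stmt-Schanuel-30564`). All parts share the namespace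
`Summit.Schanuel.Schanuel.Theorems.RootDecomp1HSpine` and the header block of the node; the module docstring of the first part
(`RootDecomp1HSpineRigid`) describes the whole node. Sorry-free; standard axioms. Nothing here proves Schanuel; rung 0.
-/

set_option linter.dupNamespace false

noncomputable section

namespace Summit.Schanuel.Schanuel.Theorems.RootDecomp1HSpine

open Complex Set
open Literature.NumberTheory.Transcendental (exists_nsmul_mem_span_int mem_adjoin_of_mem_span_int SchanuelRank Khovanskii.ePD)
open Summit.Schanuel.Schanuel.Theses.RootDecomp1H (ProductSchanuel RelTowerSchanuel BridgeTransverse FinCS)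
open Summit.Schanuel.Schanuel.Theorems.RootDecomp1HTowerCells (trdeg_adjoin_adjoin_eq trdeg_adjoin_union_le
  trdeg_adjoin_range_le)
open Summit.Schanuel.Schanuel.Theorems.RootDecomp1HCurveHull
open Summit.Schanuel.Schanuel.Theorems.RootDecomp1HClearance (LowerRanks CounterEx InTowerHull)
open Summit.Schanuel.Schanuel.Theorems.RootDecomp1HWitness
open Summit.Schanuel.Schanuel.Theorems.RootDecomp1HGauge
open Summit.Schanuel.Schanuel.Theorems.RootDecomp1HCycles (ratCast_mem mem_closure_of_isAlgebraic_closure mem_closure_of_pair)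

/-! ## 7. The node: the live deciding theorem CALLED (item set unchanged); cell `(n, 1)` placed under the route's own binders -/

section node

open Summit.Schanuel.Schanuel.Theses.RootDecomp1H (StarLocalisation FirstFailureConjStable BridgeCSGlue BridgeCoupledGlue
  BridgeCyclicGlue closes)

/- NODE (round 11): the route's deciding theorem `RootDecomp1H.closes` (rev 14/15) is CALLED verbatim by the node's
`node_closes` (critic 13:23:07Z: `@node_closes = @Theses.RootDecomp1H.closes := rfl`); that restatement is NOT ported
(print-twin of the live `closes` — dropped per the critic's T11 note); this round adds, splits or restates NO item; it
inhabits EVERY cell `(n, 1)`, `n ≥ 1`, of the instrument binder FinCS by exponential `n`-cycles, decides it there from a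
census certificate, and reads the residual binder BridgeTransverse there exactly. -/

variable {n : ℕ} [NeZero n] {ε c : Fin n → ℤ}

omit [NeZero n] in
/-- The statement decided in `finCS_cell_of_euclExclN` IS the `(n, 1, y)`-instance of `FinCSAt g` … -/
theorem finCSAt_apply_cell {g : ℕ → ℕ → ℕ} (hF : FinCSAt g) (y : Fin n → ℂ) :
    LowerRanks n → NearOpt n 1 y → ConjStable y →
      (¬ LinearIndependent ℚ y ∨
        ¬ ∃ P : Fin (n + 1) → MvPolynomial (Fin n ⊕ Fin n) ℤ, (∀ i, psize (P i) ≤ g n 1) ∧ IsCertificate n y P) :=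
  fun hlow => hF n 1 hlow y

omit [NeZero n] in
/-- … and, at `g = stdGauge`, of the live item `FinCS` (`finCSAt_std_iff`). -/
theorem finCS_apply_cell (hF : FinCS) (y : Fin n → ℂ) :
    LowerRanks n → NearOpt n 1 y → ConjStable y →
      (¬ LinearIndependent ℚ y ∨
        ¬ ∃ P : Fin (n + 1) → MvPolynomial (Fin n ⊕ Fin n) ℤ, (∀ i, psize (P i) ≤ stdGauge n 1) ∧ IsCertificate n y P) :=
  finCSAt_apply_cell (finCSAt_std_iff.2 hF) y

omit [NeZero n] in
/-- The statement read in `bridge_cell_iff_of_euclExclN` IS the `(n, 1, y)`-instance of `BridgeAt g` … -/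
theorem bridgeAt_apply_cell {g : ℕ → ℕ → ℕ} (hB : BridgeAt g) (y : Fin n → ℂ) :
    LowerRanks n → NearOpt n 1 y → ConjStable y → CounterEx y → ¬ InTowerHull y →
      ∃ P : Fin (n + 1) → MvPolynomial (Fin n ⊕ Fin n) ℤ, (∀ i, psize (P i) ≤ g n 1) ∧ IsCertificate n y P :=
  fun hlow => hB n 1 hlow y

omit [NeZero n] in
/-- … and, at `g = stdGauge`, of the live residual `BridgeTransverse` (`bridgeAt_std_iff`). -/
theorem bridgeTransverse_apply_cell (hB : BridgeTransverse) (y : Fin n → ℂ) :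
    LowerRanks n → NearOpt n 1 y → ConjStable y → CounterEx y → ¬ InTowerHull y →
      ∃ P : Fin (n + 1) → MvPolynomial (Fin n ⊕ Fin n) ℤ, (∀ i, psize (P i) ≤ stdGauge n 1) ∧ IsCertificate n y P :=
  bridgeAt_apply_cell (bridgeAt_std_iff.2 hB) y

/-- **THE CELL NODE AT RANK `n`.**  For unit parameters and a real solution `t` of the `n`-cycle equations with `|t_j| ≤ 4`,
`Σ t_j ≠ 0`, carrying the census's Euclidean certificate `EuclExclN (e^t) 4 H` with `H ≥ hBound n 4`:
(a) the LIVE INSTRUMENT instance — binder `h₂ : FinCS = FinCSAt stdGauge` of `closes` at `(n, 1, t)` — HOLDS OUTRIGHT;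
(b) for `n ≥ 3`, under the structural binders `h₃ h₄` of `closes` and `ℚ`-freeness, `t` lies in the residual's domain
    (`NearOpt n 1 ∧ ConjStable ∧ ¬ InTowerHull`), and
(c) the RESIDUAL instance — binder `h₅ : BridgeTransverse = BridgeAt stdGauge` at `(n, 1, t)` — is EXACTLY
    «`LowerRanks n → ¬ CounterEx t`», i.e. Schanuel's conjecture at `t` given the lower ranks. -/
theorem cell_nodeN (hp : UnitParamsN ε c) {t : Fin n → ℝ} (hcyc : ∀ j, t (j + 1) = ε j * Real.exp (t j) + c j)
    (hball : ∀ j, |t j| ≤ 4) (hsum : ∑ j, t j ≠ 0) {H : ℕ} (hH : hBound n 4 ≤ H)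
    (hex : EuclExclN (cexp ∘ fun j => (t j : ℂ)) 4 H) :
    (LowerRanks n → NearOpt n 1 (fun j => (t j : ℂ)) → ConjStable (fun j => (t j : ℂ)) →
      (¬ LinearIndependent ℚ (fun j => (t j : ℂ)) ∨ ¬ ∃ P : Fin (n + 1) → MvPolynomial (Fin n ⊕ Fin n) ℤ,
        (∀ i, psize (P i) ≤ stdGauge n 1) ∧ IsCertificate n (fun j => (t j : ℂ)) P)) ∧
    (3 ≤ n → ProductSchanuel → RelTowerSchanuel → LinearIndependent ℚ (fun j => (t j : ℂ)) →
      (NearOpt n 1 (fun j => (t j : ℂ)) ∧ ConjStable (fun j => (t j : ℂ)) ∧ ¬ InTowerHull (fun j => (t j : ℂ))) ∧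
      ((LowerRanks n → NearOpt n 1 (fun j => (t j : ℂ)) → ConjStable (fun j => (t j : ℂ)) →
          CounterEx (fun j => (t j : ℂ)) → ¬ InTowerHull (fun j => (t j : ℂ)) →
            ∃ P : Fin (n + 1) → MvPolynomial (Fin n ⊕ Fin n) ℤ,
              (∀ i, psize (P i) ≤ stdGauge n 1) ∧ IsCertificate n (fun j => (t j : ℂ)) P) ↔
        (LowerRanks n → ¬ CounterEx (fun j => (t j : ℂ))))) := by
  have hint := isIntCycleN_ofReal hcyc
  obtain ⟨hopt, hcs⟩ := realUnitCycleN_mem_cell hp hcyc hball hsum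
  refine ⟨finCS_cell_of_euclExclN hint hp (g := stdGauge) hH hex, fun hn hPS hRT hli => ?_⟩
  have hnh : ¬ InTowerHull (fun j => (t j : ℂ)) :=
    not_inTowerHull_cycleN_of_structural (hint.isCycleN hp.ε_ne) hn hPS hRT hli
  exact ⟨⟨hopt, hcs, hnh⟩, bridge_cell_iff_of_euclExclN hint hp (g := stdGauge) hH hex hopt hcs hnh⟩

end node

/-! ## 8. Every cell `(n, 1)` is inhabited (kernel): a real unit `n`-cycle in the ball, by the intermediate value theorem -/

section inhabited

/-- The OPEN CHAIN MAP iterated: `iter 0 x = x`, `iter (k+1) x = −e^{iter k x} − 1`. -/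
def iter : ℕ → ℝ → ℝ
  | 0, x => x
  | k + 1, x => -Real.exp (iter k x) - 1

/-- `iter 0 x = x`. -/
@[simp] theorem iter_zero (x : ℝ) : iter 0 x = x := rfl

/-- `iter (k + 1) x = -Real.exp (iter k x) - 1`. -/
@[simp] theorem iter_succ (k : ℕ) (x : ℝ) : iter (k + 1) x = -Real.exp (iter k x) - 1 := rfl

/-- Every iterate `iter k` of `x ↦ −eˣ − 1` is continuous. -/
theorem continuous_iter : ∀ k, Continuous (iter k)
  | 0 => continuous_id.congr fun x => (iter_zero x).symm
  | k + 1 => by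
    have hk := continuous_iter k
    show Continuous fun x => -Real.exp (iter k x) - 1
    fun_prop

/-- On `[−1, 0]` every iterate stays in `[−2, 0]`. -/
theorem iter_mem (k : ℕ) {x : ℝ} (hx : x ∈ Set.Icc (-1 : ℝ) 0) : iter k x ∈ Set.Icc (-2 : ℝ) 0 := by
  induction k with
  | zero => exact ⟨by rw [iter_zero]; linarith [hx.1], by rw [iter_zero]; exact hx.2⟩
  | succ k ih =>
    rw [iter_succ]
    have h1 : Real.exp (iter k x) ≤ 1 := Real.exp_le_one_iff.2 ih.2
    have h2 := Real.exp_pos (iter k x)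
    exact ⟨by linarith, by linarith⟩

/-- Every iterate of `−1` is negative. -/
theorem iter_neg_one_lt : ∀ k, iter k (-1) < 0
  | 0 => by rw [iter_zero]; norm_num
  | k + 1 => by rw [iter_succ]; linarith [Real.exp_pos (iter k (-1))]

/-- The RETURN MAP of the spine cycle at rank `m + 1`: `x ↦ −e^{iter m x}`. -/
def retMapN (m : ℕ) (x : ℝ) : ℝ := -Real.exp (iter m x)

/-- The return map has a fixed point in `[−1, 0]` (intermediate value theorem). -/
theorem exists_fixedPoint_retMapN (m : ℕ) : ∃ x ∈ Set.Icc (-1 : ℝ) 0, retMapN m x = x := by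
  have hc : ContinuousOn (fun x => retMapN m x - x) (Set.Icc (-1 : ℝ) 0) := by
    have hk := continuous_iter m
    have : Continuous fun x => retMapN m x - x := by unfold retMapN; fun_prop
    exact this.continuousOn
  have hlt0 : retMapN m 0 < 0 := neg_lt_zero.2 (Real.exp_pos _)
  have hgt : -1 < retMapN m (-1) := by
    unfold retMapN
    rw [neg_lt_neg_iff, Real.exp_lt_one_iff]
    exact iter_neg_one_lt m
  have h0 : (0 : ℝ) ∈ Set.Icc (retMapN m 0 - 0) (retMapN m (-1) - (-1)) := ⟨by linarith, by linarith⟩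
  obtain ⟨x, hx, hx0⟩ := intermediate_value_Icc' (by norm_num) hc h0
  exact ⟨x, hx, sub_eq_zero.1 hx0⟩

/-- The SPINE PARAMETERS at rank `m + 1`: `ε ≡ −1`; `c_j = −1` except `c_last = 0`
(`y_{j+1} = −e^{y_j} − 1` along the chain, `y_0 = −e^{y_m}` closing it). -/
def εSp (m : ℕ) : Fin (m + 1) → ℤ := fun _ => -1

/-- See `εSp`. -/
def cSp (m : ℕ) : Fin (m + 1) → ℤ := fun j => if j = Fin.last m then 0 else -1

/-- `UnitParamsN (εSp m) (cSp m)`. -/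
theorem unitParamsN_sp (m : ℕ) : UnitParamsN (εSp m) (cSp m) :=
  ⟨fun _ => Or.inr rfl, fun j => by unfold cSp; split_ifs <;> simp⟩

/-- **A REAL UNIT `(m+1)`-CYCLE IN THE BALL EXISTS FOR EVERY `m`** (kernel, no census): coordinates in `[−2, 0]`, `y_0 < 0`,
hence `Σ y_j ≠ 0`. -/
theorem exists_realUnitCycleN (m : ℕ) : ∃ t : Fin (m + 1) → ℝ,
    (∀ j, t (j + 1) = εSp m j * Real.exp (t j) + cSp m j) ∧ (∀ j, |t j| ≤ 4) ∧ ∑ j, t j ≠ 0 := by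
  obtain ⟨x, hx, hfix⟩ := exists_fixedPoint_retMapN m
  have hfix' : -Real.exp (iter m x) = x := hfix
  refine ⟨fun j => iter j.val x, fun j => ?_, fun j => ?_, ?_⟩
  · show iter (j + 1).val x = εSp m j * Real.exp (iter j.val x) + cSp m j
    by_cases hj : j = Fin.last m
    · subst hj
      rw [Fin.last_add_one, Fin.val_zero, iter_zero, Fin.val_last]
      simp only [cSp, εSp, if_true]
      push_cast
      linarith
    · rw [Fin.val_add_one_of_lt (lt_of_le_of_ne (Fin.le_last j) hj), iter_succ]
      simp only [cSp, εSp, hj, if_false]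
      push_cast
      ring
  · show |iter j.val x| ≤ 4
    have := iter_mem j.val hx
    exact abs_le.2 ⟨by linarith [this.1], by linarith [this.2]⟩
  · refine ne_of_lt ?_
    show ∑ j : Fin (m + 1), iter j.val x < 0
    have h0 : iter (0 : Fin (m + 1)).val x < 0 := by
      rw [Fin.val_zero, iter_zero, ← hfix']; exact neg_lt_zero.2 (Real.exp_pos _)
    have hrest : ∑ j ∈ Finset.univ.erase (0 : Fin (m + 1)), iter j.val x ≤ 0 :=
      Finset.sum_nonpos fun j _ => (iter_mem j.val hx).2
    rw [← Finset.add_sum_erase Finset.univ (fun j : Fin (m + 1) => iter j.val x) (Finset.mem_univ 0)]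
    linarith

/-- **EVERY CELL `(n, 1)`, `n = m + 1 ≥ 1`, IS INHABITED BY AN EXPONENTIAL `n`-CYCLE** (kernel): there is a real unit
`n`-cycle `y` with `NearOpt n 1 y ∧ ConjStable y` — both inline hypotheses of `FinCS` and the first two of
`BridgeTransverse` — which for `n ≥ 3` is moreover off the tower hull under the route's structural binders whenever it is
`ℚ`-free, and at which the instrument instance follows from a Euclidean census certificate of height `≥ hBound n 4` while the
residual instance reads «`LowerRanks n → ¬ CounterEx y`». -/
theorem cell_inhabitedN (m : ℕ) : ∃ y : Fin (m + 1) → ℂ, IsIntCycleN (εSp m) (cSp m) y ∧ NearOpt (m + 1) 1 y ∧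
    ConjStable y ∧ (∀ j, (y j).im = 0) ∧
    (3 ≤ m + 1 → ProductSchanuel → RelTowerSchanuel → LinearIndependent ℚ y → ¬ InTowerHull y) ∧
    (∀ H, hBound (m + 1) 4 ≤ H → EuclExclN (cexp ∘ y) 4 H →
      (LowerRanks (m + 1) → NearOpt (m + 1) 1 y → ConjStable y →
        (¬ LinearIndependent ℚ y ∨ ¬ ∃ P : Fin (m + 1 + 1) → MvPolynomial (Fin (m + 1) ⊕ Fin (m + 1)) ℤ,
          (∀ i, psize (P i) ≤ stdGauge (m + 1) 1) ∧ IsCertificate (m + 1) y P)) ∧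
      (¬ InTowerHull y →
        ((LowerRanks (m + 1) → NearOpt (m + 1) 1 y → ConjStable y → CounterEx y → ¬ InTowerHull y →
            ∃ P : Fin (m + 1 + 1) → MvPolynomial (Fin (m + 1) ⊕ Fin (m + 1)) ℤ,
              (∀ i, psize (P i) ≤ stdGauge (m + 1) 1) ∧ IsCertificate (m + 1) y P) ↔
          (LowerRanks (m + 1) → ¬ CounterEx y)))) := by
  obtain ⟨t, hcyc, hball, hsum⟩ := exists_realUnitCycleN m
  have hint := isIntCycleN_ofReal hcyc
  obtain ⟨hopt, hcs⟩ := realUnitCycleN_mem_cell (unitParamsN_sp m) hcyc hball hsum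
  refine ⟨fun j => (t j : ℂ), hint, hopt, hcs, fun j => Complex.ofReal_im _, fun hn hPS hRT hli =>
    not_inTowerHull_cycleN_of_structural (hint.isCycleN (unitParamsN_sp m).ε_ne) hn hPS hRT hli, fun H hH hex => ?_⟩
  exact ⟨finCS_cell_of_euclExclN hint (unitParamsN_sp m) (g := stdGauge) hH hex, fun hnh =>
    bridge_cell_iff_of_euclExclN hint (unitParamsN_sp m) (g := stdGauge) hH hex hopt hcs hnh⟩

end inhabited

end Summit.Schanuel.Schanuel.Theorems.RootDecomp1HSpine
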